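import Literature.NumberTheory.LFunctions.DirichletLTruncationPacked
import Literature.NumberTheory.LFunctions.FeketePolyaKernelSignTablesWide
import HarnessLib

/-!
# Packed truncation certificate data for the conductor `13340` (frame: coverage of [1/2,1] by the 67 cells and the U-walk)

Kernel evaluation (`decide +kernel`) of one piece of the packed truncation certificate (Chua's ALGO 1, `K = 16` periods,
`G = 128`, `E = 2^11`, `P = 40`, digit width `72`) for the even primitive quadratic character of conductor `13340 = 4·5·23·29`
(`B⁻ = 2884`); consumed by the soundness theorem of `LTruncationPacked.certTcells` / `certTframe`.
[cite: Chua2005RealZeros, §2.2 ALGO 1]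
-/

namespace Literature.NumberTheory.LFunctions

namespace LTruncationPacked

open FeketePolyaKernel

set_option maxHeartbeats 0 in
/-- frame: coverage of [1/2,1] by the 67 cells and the U-walk: the check passes. [cite: Chua2005RealZeros, §2.2 ALGO 1] -/
theorem certTframe_13340 :
    certTframe 72 15 11 13340 2884
      [(1024, 1), (1025, 1), (1026, 1), (1027, 1), (1028, 1), (1029, 1), (1030, 1), (1031, 1), (1032, 1), (1033, 1), (1034, 1), (1035, 2), (1037, 2), (1039, 2), (1041, 2), (1043, 2), (1045, 2), (1047, 2), (1049, 2), (1051, 2), (1053, 2), (1055, 2), (1057, 2), (1059, 2), (1061, 2), (1063, 2), (1065, 4), (1069, 4), (1073, 4), (1077, 4), (1081, 4), (1085, 4), (1089, 4), (1093, 4), (1097, 4), (1101, 4), (1105, 4), (1109, 4), (1113, 4), (1117, 4), (1121, 4), (1125, 4), (1129, 8), (1137, 8), (1145, 8), (1153, 8), (1161, 8), (1169, 8), (1177, 8), (1185, 8), (1193, 8), (1201, 8), (1209, 8), (1217, 8), (1225, 8), (1233, 32), (1265, 32), (1297, 32), (1329, 32), (1361, 32), (1393, 32), (1425, 32), (1457,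 64), (1521, 64), (1585, 64), (1649, 256), (1905, 256)]
      (plainTabsC 1 72 47 [5, 23, 29] 13340) = true := by
  decide +kernel

end LTruncationPacked

end Literature.NumberTheory.LFunctions
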